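/-
Copyright (c) 2026. Released under Apache 2.0 license as described in the file LICENSE.
-/
import Summits.RiemannHypothesis.RiemannHypothesis.Theorems.LiDirichletKernelTrendFormula
import Summits.RiemannHypothesis.RiemannHypothesis.Theorems.LiDirichletKernelEncl
import Summits.RiemannHypothesis.RiemannHypothesis.Theorems.LiKernelTableCorollaries
import HarnessLib

/-!
# KERNEL LINEAGE K-χ — soundness III (part 2): the program `trendRows` encloses `lb_χ(n) = charLiTrend χ n`

RH-FREE, GRH-FREE.  bears_on: LADDER-RH L-D (Dirichlet rows).  WHAT THIS IS NOT: nothing here bears on the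
truth of RH or GRH.

Boxes of the constants (`γ` from the kernel decimals of `Theorems/LiKernelTableCorollaries.lean`, `log π`, `t₁`,
`ζ(j)` by `Xiao2020.CertKernel.zetaBox`), the data list `trendData`, the signed binomial rows `trendSeq`, and
`encl_trendRows`: for every character `χ mod q` the program encloses `j ↦ lb_χ(1+j)`
(`charLiTrend_eq_finite_sum`, `Theorems/LiDirichletKernelTrendFormula.lean`).
-/

set_option linter.dupNamespace false

namespace Summit.RiemannHypothesis.RiemannHypothesis.Theorems.LiDirichletKernel

open Literature.Analysis.ValidatedNumerics Literature.Analysis.ValidatedNumerics.NumericsMP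
open Literature.NumberTheory.LFunctions Literature.NumberTheory.LFunctions.Xiao2020
open Literature.NumberTheory.LFunctions.Xiao2020.CertKernel
open Summit.RiemannHypothesis.RiemannHypothesis.Theorems.LiTheory
open Summit.RiemannHypothesis.RiemannHypothesis.Theorems.LiKernel
open Finset Complex
open scoped Nat

/-! ## Enclosures of the constants -/

variable {S : ℕ}

/-- `gammaBox ∋ γ` (the kernel decimals of `Theorems/LiKernelTableCorollaries.lean`). -/
theorem mem_gammaBox (S : ℕ) : MI.mem S Real.eulerMascheroniConstant (gammaBox S) := by
  refine MI.mem_span (mem_ratBox S _) (mem_ratBox S _) ?_ ?_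
  · have := eulerMascheroniConstant_gt_d49
    refine le_of_lt (lt_of_eq_of_lt ?_ this)
    push_cast; norm_num
  · have := eulerMascheroniConstant_lt_d47
    refine le_of_lt (lt_of_lt_of_eq this ?_)
    push_cast; norm_num

/-- `logPiBox` encloses `log π`. -/
theorem mem_logPiBox (hS : 0 < S) {KL : ℕ} {piI L2 Y : MI} (hpi : MI.mem S Real.pi piI)
    (hL2 : MI.mem S (Real.log 2) L2) (h : logPiBox S KL piI L2 = some Y) : MI.mem S (Real.log Real.pi) Y := by
  unfold logPiBox at h
  split at h
  · rename_i Z hZ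
    simp only [Option.some.injEq] at h
    subst h
    have hx : MI.mem S (1 - Real.pi / 4) ((MI.ofInt S 1).sub (piI.divNat 4)) := by
      have := MI.mem_sub (MI.mem_ofInt S 1) (MI.mem_divNat hpi (n := 4) (by norm_num))
      simpa using this
    have h1 := MI.mem_logOneSub hS hZ hx
    have e : Real.log (1 - (1 - Real.pi / 4)) = Real.log Real.pi - Real.log 2 * 2 := by
      rw [show (1 : ℝ) - (1 - Real.pi / 4) = Real.pi / 4 by ring, Real.log_div Real.pi_pos.ne' (by norm_num),
        show (4 : ℝ) = 2 ^ 2 by norm_num, Real.log_pow]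
      ring
    rw [e] at h1
    have := MI.mem_add h1 (MI.mem_mulInt hL2 2)
    convert this using 1
    push_cast
    ring
  · simp at h

/-- `t1Box` encloses `t₁(q,a)`. -/
theorem mem_t1Box {q a : ℕ} {logq logpi gam L2 : MI} (hq : MI.mem S (Real.log q) logq)
    (hpi : MI.mem S (Real.log Real.pi) logpi) (hg : MI.mem S Real.eulerMascheroniConstant gam)
    (hL2 : MI.mem S (Real.log 2) L2) : MI.mem S (trendT1 q a) (t1Box logq logpi gam L2 a) := by
  unfold t1Box trendT1
  have hb : MI.mem S ((Real.log q - Real.log Real.pi - Real.eulerMascheroniConstant) / (2 : ℕ))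
      (((logq.sub logpi).sub gam).divNat 2) := MI.mem_divNat (MI.mem_sub (MI.mem_sub hq hpi) hg) (by norm_num)
  split_ifs with ha
  · have := MI.mem_sub hb hL2
    convert this using 1
    push_cast; ring
  · convert hb using 1
    push_cast; ring

/-- `zetaList` encloses `j ↦ ζ(j+2)`, `j < len − 1`. -/
theorem encl_zetaList (S : ℕ) {cs : List ℚ} {Nz νz len : ℕ} (hN : 1 ≤ Nz) (hν : νz ≠ 0)
    (hcs : ∀ j < νz, cs.getD (j + 1) 0 = ZetaNumerics.emCoeff (j + 1)) (hlen : νz + 1 ≤ cs.length) :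
    (zetaList S cs Nz νz len).length = len - 1 ∧
      Encl S (fun j ↦ (riemannZeta ((j + 2 : ℕ) : ℂ)).re) (zetaList S cs Nz νz len) := by
  refine ⟨by simp [zetaList], ?_⟩
  have := encl_tabulate (S := S) (F := fun j ↦ zetaBox S cs Nz νz (j + 2))
    (f := fun j ↦ (riemannZeta ((j + 2 : ℕ) : ℂ)).re) (B := len - 1)
    (fun k _ ↦ mem_zetaBox S hN hν (by omega) hcs hlen) 0 (len - 1) (by omega)
  simpa [zetaList] using this

/-! ## The trend rows -/

/-- The data `A_k` of the trend: `A_0 = 0`, `A_1 = −t₁`, `A_k = w_k(a) ζ(k)` (`k ≥ 2`). -/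
noncomputable def trendA (q a k : ℕ) : ℝ :=
  if k = 0 then 0 else if k = 1 then -trendT1 q a else trendW a k * (riemannZeta (k : ℂ)).re

/-- `charLiTrend` as the signed binomial sum of the `A_k` over any range `[0, N]`, `n ≤ N`. -/
theorem charLiTrend_eq_sum_trendA {q : ℕ} (hq : 0 < q) (χ : DirichletCharacter ℂ q) {n N : ℕ} (hn : 1 ≤ n)
    (hN : n ≤ N) :
    charLiTrend χ n = ∑ k ∈ range (N + 1), (-1) ^ k * (n.choose k : ℝ) * trendA q (charParity χ) k := by
  rw [charLiTrend_eq_finite_sum hq χ hn, Finset.range_eq_Ico,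
    ← Finset.sum_Ico_consecutive _ (show 0 ≤ 2 by omega) (show 2 ≤ N + 1 by omega), Finset.Ico_add_one_right_eq_Icc]
  have h01 : ∑ k ∈ Ico 0 2, (-1 : ℝ) ^ k * (n.choose k : ℝ) * trendA q (charParity χ) k = n * trendT1 q (charParity χ) := by
    rw [show Ico 0 2 = range 2 by rfl, sum_range_succ, sum_range_succ, sum_range_zero]
    simp [trendA]
  rw [h01]
  congr 1
  rw [← sum_subset (Icc_subset_Icc_right hN) (fun k hk hk' ↦ by
    rw [mem_Icc] at hk hk'
    rw [Nat.choose_eq_zero_of_lt (by omega), Nat.cast_zero, mul_zero, zero_mul])]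
  refine sum_congr rfl fun k hk ↦ ?_
  rw [mem_Icc] at hk
  rw [trendA, if_neg (by omega), if_neg (by omega)]
  ring

/-- Length of `trendData`. -/
@[simp] theorem length_trendData (Z : List MI) (t1 : MI) (a len : ℕ) : (trendData Z t1 a len).length = len + 1 := by
  simp [trendData]

/-- `trendData` encloses `A`. -/
theorem encl_trendData {q a len : ℕ} {Z : List MI} {t1 : MI}
    (hZ : Encl S (fun j ↦ (riemannZeta ((j + 2 : ℕ) : ℂ)).re) Z) (hZl : Z.length = len - 1)
    (ht1 : MI.mem S (trendT1 q a) t1) : Encl S (trendA q a) (trendData Z t1 a len) := by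
  unfold trendData
  have key : ∀ k < len + 1, MI.mem S (trendA q a k)
      (if k = 0 then zeroI else if k = 1 then t1.neg else
        if a = 0 then (Z.getD (k - 2) zeroI).sub ((Z.getD (k - 2) zeroI).divNat (2 ^ k))
        else (Z.getD (k - 2) zeroI).divNat (2 ^ k)) := by
    intro k hk
    rcases Nat.lt_or_ge k 2 with h2 | h2
    · interval_cases k
      · simpa [trendA] using mem_zeroI S
      · simpa [trendA] using MI.mem_neg ht1
    · have hz : MI.mem S (riemannZeta (k : ℂ)).re (Z.getD (k - 2) zeroI) := by
        have := hZ.getD (i := k - 2) (by omega)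
        rwa [show k - 2 + 2 = k by omega] at this
      rw [if_neg (by omega), if_neg (by omega), trendA, if_neg (by omega), if_neg (by omega), trendW]
      have hp : 0 < 2 ^ k := Nat.pow_pos two_pos
      split_ifs with ha
      · have := MI.mem_sub hz (MI.mem_divNat hz hp)
        convert this using 1
        push_cast; ring
      · have := MI.mem_divNat hz hp
        convert this using 1
        push_cast; ring
  have := encl_tabulate (S := S) (B := len + 1) key 0 (len + 1) (by omega)
  simpa using this

/-- `srow` reads the signed weights `(−1)^k C(n,k)` off the binomial row of `n`. -/
theorem srow_spec {n len : ℕ} {R : List ℕ} (h : RowIs n.choose len R) :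
    (srow len R).length = len ∧ ∀ k < len, (srow len R).getD k 0 = (-1) ^ k * ((n.choose k : ℕ) : ℤ) := by
  refine ⟨by simp [srow, h.1], fun k hk ↦ ?_⟩
  rw [srow, getD_zipWith_lt _ (by simpa using hk) (by rw [h.1]; exact hk) 0 0 0, h.2 k hk,
    List.getD_eq_getElem?_getD, List.getElem?_range hk]
  simp only [Option.getD_some]
  rcases Nat.even_or_odd k with he | ho
  · rw [if_pos (Nat.even_iff.1 he), he.neg_one_pow, one_mul]
  · rw [if_neg (by rw [Nat.odd_iff.1 ho]; omega), ho.neg_one_pow]; ring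

/-- Length of `trendSeq`. -/
@[simp] theorem length_trendSeq (len : ℕ) (A : List MI) : ∀ (R : List ℕ) (c : ℕ), (trendSeq len A R c).length = c
  | _, 0 => rfl
  | R, c + 1 => by simp [trendSeq, length_trendSeq]

/-- `trendSeq` encloses `j ↦ Σ_k (−1)^k C(n+j,k) a_k`. -/
theorem encl_trendSeq {a : ℕ → ℝ} {A : List MI} (hA : Encl S a A) {len : ℕ} (hAl : A.length = len) :
    ∀ (c n : ℕ) (R : List ℕ), RowIs n.choose len R →
      Encl S (fun j ↦ ∑ k ∈ range len, (-1) ^ k * (((n + j).choose k : ℕ) : ℝ) * a k) (trendSeq len A R c)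
  | 0, _, _, _ => trivial
  | c + 1, n, R, hR => by
    simp only [trendSeq]
    refine ⟨?_, ?_⟩
    · obtain ⟨hl, he⟩ := srow_spec hR
      have hdot := mem_dotZ (srow len R) hA
      rw [hl, hAl, min_self] at hdot
      have hsum : ∑ k ∈ range len, ((srow len R).getD k 0 : ℝ) * a k =
          ∑ k ∈ range len, (-1) ^ k * ((n.choose k : ℕ) : ℝ) * a k :=
        sum_congr rfl fun k hk ↦ by rw [he k (mem_range.1 hk)]; push_cast; ring
      rw [hsum] at hdot
      simpa using hdot
    · have := encl_trendSeq hA hAl c (n + 1) (pascalNext R) (rowIs_pascalNext hR)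
      exact this.congr' fun j ↦ by simp [add_assoc, add_comm 1 j]

/-- **The `lb`-rows**: for a character `χ mod q` (`q ≥ 1`) of parity `a`, `trendRows` encloses `j ↦ lb_χ(1 + j)`,
`j < IMAX`, from boxes of `log q`, `log π`, `log 2` and `Z ∋ (ζ(2), …, ζ(IMAX))`. -/
theorem encl_trendRows {q : ℕ} (hq : 0 < q) (χ : DirichletCharacter ℂ q) {logq logpi L2 : MI} {Z : List MI}
    (hlq : MI.mem S (Real.log q) logq) (hpi : MI.mem S (Real.log Real.pi) logpi) (hL2 : MI.mem S (Real.log 2) L2)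
    (hZ : Encl SK (fun j ↦ (riemannZeta ((j + 2 : ℕ) : ℂ)).re) Z) (hZl : Z.length = IMAX - 1) (hS : S = SK) :
    Encl S (fun j ↦ charLiTrend χ (1 + j)) (trendRows logq logpi L2 Z (charParity χ)) := by
  subst hS
  unfold trendRows
  have hA := encl_trendData (q := q) (a := charParity χ) hZ hZl (mem_t1Box hlq hpi (mem_gammaBox SK) hL2)
  have h := encl_trendSeq hA (length_trendData _ _ _ _) IMAX 1 _ (rowIs_pascalNext (rowIs_row0 IMAX))
  refine h.congr fun j hj ↦ ?_
  rw [length_trendSeq] at hj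
  rw [charLiTrend_eq_sum_trendA hq χ (n := 1 + j) (N := IMAX) (by omega) (by omega)]

end Summit.RiemannHypothesis.RiemannHypothesis.Theorems.LiDirichletKernel
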